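import Summits.AtomisticToContinuum.HydrodynamicLimit.Theorems.BoxDissipativeWeakStrongFluxClosureEqKinStatic
import HarnessLib

/-!
# Crux `FluxClosure` (stmt-AtomisticToContinuum-9902, route BoxDissipativeWeakStrong), line `registered`:
# Gaussian statics of the kinetic-isotropy integrand under a GENERAL local Gibbs measure (sub-goal G1)

Support file (`--supports stmt-AtomisticToContinuum-9902`) for the crux
`Summit.AtomisticToContinuum.HydrodynamicLimit.Theses.BoxDissipativeWeakStrong.FluxClosure`: the registered sub-goal
G1 `kinStatic_lintegral_localGibbs_general_le`, i.e. the rung-0 Gaussian statics of the kinetic stub K (sub-goal E6,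
file `…FluxClosureEqKinStatic`, CONSTANT profiles) for GENERAL continuous profiles `(a₀, u₀, θ₀)`. Under
`localGibbsMeasure σ a₀ u₀ θ₀ N` (`σ ≤ 1/2`), given the positions the velocities are INDEPENDENT Gaussians
`vₐ ~ N(u₀(qₐ), θ₀(qₐ)𝟙)` (`velMeasure`, disintegration `lintegral_localGibbsMeasure`). For a jointly measurable
kernel `0 ≤ K ≤ C_K` of unit mass in its centre variable, LOCAL for the profiles
(`K(x, y) ≠ 0 ⇒ ‖u₀ y - u₀ x‖ ≤ δu, |θ₀ y - θ₀ x| ≤ δθ`), and a matrix field `|Gᵢⱼ| ≤ B`, the traceless box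
peculiar velocity covariance `A = Ŝ - m̂⊗m̂/ρ̂ - ρ̂θ̂𝟙` of the `K(x, ·)`-weighted box fields satisfies
`E_{P_N} |∫ₓ Σᵢⱼ Aᵢⱼ Gᵢⱼ dx| ≤ B C (√((N+1)⁻¹ C_K) + (N+1)⁻¹ C_K + δθ + δu²)`, `C = 18√(θ_max² M₄) + 54 θ_max + 72`.

* `kinStatic_lintegral_vel_general_le` — conditional bound given the positions: the pointwise traceless bound
  `E6.kinStatic_abs_kinEntry_le` at the reference `(u, θ) := (u₀ x, θ₀ x)`; the `u`-centred second moments split as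
  `Z = Y + P + Pᵀ + β`, `Y` a Bienaymé sum of independent CENTRED variables (`MesoLLN.integral_sq_sum_sub_pi`),
  `P` a momentum fluctuation with coefficients `≤ C_χ δu` (`LGFS.integral_abs_momFluct_le`, AM–GM), bias
  `|β| ≤ ρ̂(δu² + δθ)`; `E D_k² ≤ n⁻¹C_χθ_max ρ̂ + ρ̂²δu²` (`MesoLLN.integral_momCoord_sq`). Affine in `ρ̂`.
* `kinStatic_lintegral_localGibbs_general_le` — `|∫ₓ| ≤ ∫ₓ|·|`, Tonelli (`FluxClosureB5.measurable_kinDevIntegrand`),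
  the disintegration, `∫ₓ ρ̂(q, x) dx = 1`, `lintegral_posWeight_eq_one`; `θ_max` by compactness of `𝕋³`.

No definitions. References: H. Spohn, *Large Scale Dynamics of Interacting Particles* (1991), Part I §2.3
(local equilibrium states: Maxwellian velocities given the positions), §3.3.
-/

noncomputable section

namespace Summit.AtomisticToContinuum.HydrodynamicLimit.Theorems
namespace FluxClosureEq.G1

open scoped BigOperators Topology Classical MeasureTheory ProbabilityTheory InnerProductSpace ENNReal
open Filter Set Function MeasureTheory ProbabilityTheory
open Literature.MathematicalPhysics.KineticTheory Literature.Analysis.FluidPDE Literature.Analysis.FunctionSpaces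
open Summit.AtomisticToContinuum.HydrodynamicLimit.Theses.BoxDissipativeWeakStrong

variable {n : ℕ}

/-! ### Elementary inequalities -/

/-- A sum of three terms each at most `c` is at most `3 c`. -/
theorem sum_fin_three_le {f : Fin 3 → ℝ} {c : ℝ} (h : ∀ k, f k ≤ c) : ∑ k, f k ≤ 3 * c :=
  (Finset.sum_le_sum fun k _ => h k).trans_eq (by simp)

/-- Weighted averages of quantities bounded on the support of the weight: if `|fₐ| ≤ δ` whenever the weight
`cₐ ≥ 0` is nonzero, then `|n⁻¹ Σₐ cₐ fₐ| ≤ (n⁻¹ Σₐ cₐ) δ`. -/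
theorem abs_avg_mul_le {c f : Fin n → ℝ} {δ : ℝ} (hc0 : ∀ a, 0 ≤ c a) (hf : ∀ a, c a ≠ 0 → |f a| ≤ δ) :
    |(n : ℝ)⁻¹ * ∑ a, c a * f a| ≤ ((n : ℝ)⁻¹ * ∑ a, c a) * δ := by
  rw [abs_mul, abs_of_nonneg (inv_nonneg.2 (Nat.cast_nonneg n)), mul_assoc, Finset.sum_mul]
  refine mul_le_mul_of_nonneg_left ((Finset.abs_sum_le_sum_abs _ _).trans (Finset.sum_le_sum fun a _ => ?_))
    (inv_nonneg.2 (Nat.cast_nonneg n))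
  rw [abs_mul, abs_of_nonneg (hc0 a)]
  rcases eq_or_ne (c a) 0 with h | h
  · rw [h, zero_mul, zero_mul]
  · exact mul_le_mul_of_nonneg_left (hf a h) (hc0 a)

/-- Kinetic-window bound for conditional variances, with a bound valid on the support of the weight: for
`0 ≤ cₐ ≤ C`, `0 ≤ bₐ`, and `bₐ ≤ B` whenever `cₐ ≠ 0`, `Σₐ (n⁻¹cₐ)² bₐ ≤ (n⁻¹ C B)(n⁻¹ Σₐ cₐ)`. -/
theorem sum_sq_mul_le_of_support {c b : Fin n → ℝ} {C B : ℝ} (hc0 : ∀ a, 0 ≤ c a) (hcC : ∀ a, c a ≤ C)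
    (hb0 : ∀ a, 0 ≤ b a) (hbB : ∀ a, c a ≠ 0 → b a ≤ B) :
    ∑ a, ((n : ℝ)⁻¹ * c a) ^ 2 * b a ≤ ((n : ℝ)⁻¹ * C * B) * ((n : ℝ)⁻¹ * ∑ a, c a) := by
  rw [Finset.mul_sum, Finset.mul_sum]
  refine Finset.sum_le_sum fun a _ => ?_
  rcases eq_or_ne (c a) 0 with h | h
  · simp [h]
  · have h1 : ((n : ℝ)⁻¹ * c a) ^ 2 * b a = (n : ℝ)⁻¹ * (n : ℝ)⁻¹ * c a * (c a * b a) := by ring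
    have h2 : (n : ℝ)⁻¹ * C * B * ((n : ℝ)⁻¹ * c a) = (n : ℝ)⁻¹ * (n : ℝ)⁻¹ * c a * (C * B) := by ring
    rw [h1, h2]
    exact mul_le_mul_of_nonneg_left (mul_le_mul (hcC a) (hbB a h) (hb0 a) ((hc0 a).trans (hcC a)))
      (by have := hc0 a; positivity)

/-! ### Gaussian statics given the positions, general profiles -/

/-- **Conditional (velocity) bound, general profiles.** Given positions `q` of `n` particles, a weight
`0 ≤ χ ≤ C_χ`, a reference `(u, θ)` with `‖u₀ y - u‖ ≤ δu`, `|θ₀ y - θ| ≤ δθ` wherever `χ y ≠ 0`, and profiles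
`0 < θ₀ ≤ θ_max`: under the Maxwellian velocity law `⊗ₐ N(u₀(qₐ), θ₀(qₐ)𝟙)` the summed absolute K-integrand of
`zipConfig (q, v)` has expectation at most `(9√κ + 54 n⁻¹C_χθ_max) + (9√κ + 72 δu² + 18 δθ) ρ̂`
(`ρ̂ = n⁻¹Σₐ χ(qₐ)`, `κ = n⁻¹ C_χ θ_max² M₄`, `M₄ = E‖w‖⁴`): the traceless bound `E6.kinStatic_abs_kinEntry_le` at
`(u, θ)`, the split `Z = Y + P + Pᵀ + β` of the `u`-centred second moments around the local means (centred
Bienaymé sum, two momentum fluctuations, bias `≤ ρ̂(δu² + δθ)`), and `E D_k² ≤ n⁻¹C_χθ_max ρ̂ + ρ̂²δu²`. -/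
theorem kinStatic_lintegral_vel_general_le {u₀ : T3 → V3} {θ₀ : T3 → ℝ} {θM : ℝ} (hθ0 : ∀ x, 0 < θ₀ x)
    (hθM : ∀ x, θ₀ x ≤ θM) (q : Fin n → T3) {χ : T3 → ℝ} {Cχ : ℝ} (hχ0 : ∀ y, 0 ≤ χ y) (hχC : ∀ y, χ y ≤ Cχ)
    (u : V3) (θ : ℝ) {δu δθ : ℝ} (hloc : ∀ y, χ y ≠ 0 → ‖u₀ y - u‖ ≤ δu ∧ |θ₀ y - θ| ≤ δθ) (hδθ : 0 ≤ δθ) :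
    ∫⁻ v, ENNReal.ofReal (∑ i, ∑ j,
      |(∫ y, χ y.1 * (y.2 i * y.2 j) ∂(empiricalMeasure (zipConfig (q, v)))) -
        empiricalMomentumField (zipConfig (q, v)) χ i * empiricalMomentumField (zipConfig (q, v)) χ j /
          empiricalDensityField (zipConfig (q, v)) χ -
        (if i = j then empiricalDensityField (zipConfig (q, v)) χ *
          (2 / 3 * (empiricalEnergyField (zipConfig (q, v)) χ / empiricalDensityField (zipConfig (q, v)) χ -
            ‖empiricalMomentumField (zipConfig (q, v)) χ‖ ^ 2 / (2 * empiricalDensityField (zipConfig (q, v)) χ ^ 2)))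
        else 0)|) ∂(velMeasure u₀ θ₀ q) ≤
      ENNReal.ofReal ((9 * Real.sqrt ((n : ℝ)⁻¹ * Cχ * (θM ^ 2 * ∫ w, ‖w‖ ^ 4 ∂stdGaussian V3)) +
          54 * ((n : ℝ)⁻¹ * Cχ * θM)) +
        (9 * Real.sqrt ((n : ℝ)⁻¹ * Cχ * (θM ^ 2 * ∫ w, ‖w‖ ^ 4 ∂stdGaussian V3)) + 72 * δu ^ 2 + 18 * δθ) *
          ((n : ℝ)⁻¹ * ∑ a, χ (q a))) := by
  -- abbreviations: the (velocity-independent) density `R` and the fourth moment `M₄`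
  obtain ⟨R, hR⟩ : ∃ R : ℝ, R = (n : ℝ)⁻¹ * ∑ a, χ (q a) := ⟨_, rfl⟩
  obtain ⟨M₄, hM₄⟩ : ∃ M : ℝ, M = ∫ w, ‖w‖ ^ 4 ∂stdGaussian V3 := ⟨_, rfl⟩
  rw [← hR, ← hM₄]
  have hμv : velMeasure u₀ θ₀ q = Measure.pi fun a : Fin n => gaussMeasure (u₀ (q a)) (θ₀ (q a)) := rfl
  have hκ0 : ∀ a, 0 ≤ χ (q a) := fun a => hχ0 _
  have hκC : ∀ a, χ (q a) ≤ Cχ := fun a => hχC _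
  have hCχ : 0 ≤ Cχ := (hχ0 0).trans (hχC 0)
  have hR0 : 0 ≤ R := by
    rw [hR]; exact mul_nonneg (inv_nonneg.2 (Nat.cast_nonneg n)) (Finset.sum_nonneg fun a _ => hκ0 a)
  have hM₄0 : 0 ≤ M₄ := by rw [hM₄]; exact integral_nonneg fun w => by positivity
  have hθM0 : 0 ≤ θM := (hθ0 0).le.trans (hθM 0)
  have hK0 : 0 ≤ (n : ℝ)⁻¹ * Cχ * (θM ^ 2 * M₄) := by positivity
  have hDens : ∀ v, empiricalDensityField (zipConfig (q, v)) χ = R := fun v => by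
    rw [hR]; exact LGFS.empiricalDensityField_zip q v χ
  simp only [hDens]
  -- locality of the profiles on the support of the weight, read at the particles
  have hdu : ∀ a, χ (q a) ≠ 0 → ∀ k, |u₀ (q a) k - u k| ≤ δu := fun a ha k =>
    le_trans (by simpa using PiLp.norm_apply_le (u₀ (q a) - u) k) (hloc (q a) ha).1
  -- the variables: `Z`, `D` of the traceless bound; `Y` (centred), `P` (momentum fluctuation), `β` (bias)
  obtain ⟨Z, hZ⟩ : ∃ Z : Fin 3 → Fin 3 → (Fin n → V3) → ℝ, ∀ i j v, Z i j v =
      (∑ a, (n : ℝ)⁻¹ * χ (q a) * ((v a i - u i) * (v a j - u j))) - (if i = j then θ * R else 0) :=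
    ⟨_, fun _ _ _ => rfl⟩
  obtain ⟨D, hD⟩ : ∃ D : Fin 3 → (Fin n → V3) → ℝ, ∀ k v, D k v =
      (n : ℝ)⁻¹ * ∑ a, χ (q a) * v a k - (n : ℝ)⁻¹ * ∑ a, χ (q a) * u k := ⟨_, fun _ _ => rfl⟩
  obtain ⟨Y, hY⟩ : ∃ Y : Fin 3 → Fin 3 → (Fin n → V3) → ℝ, ∀ i j, Y i j = fun v =>
      (∑ a, (n : ℝ)⁻¹ * χ (q a) * ((v a i - u₀ (q a) i) * (v a j - u₀ (q a) j))) -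
        ∑ a, (n : ℝ)⁻¹ * χ (q a) * (if i = j then θ₀ (q a) else 0) := ⟨_, fun _ _ => rfl⟩
  obtain ⟨P, hP⟩ : ∃ P : Fin 3 → Fin 3 → (Fin n → V3) → ℝ, ∀ i j, P i j = fun v =>
      (n : ℝ)⁻¹ * ∑ a, χ (q a) * (u₀ (q a) j - u j) * (v a i - u₀ (q a) i) := ⟨_, fun _ _ => rfl⟩
  obtain ⟨β, hβ⟩ : ∃ β : Fin 3 → Fin 3 → ℝ, ∀ i j, β i j = (n : ℝ)⁻¹ * ∑ a, χ (q a) *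
      ((u₀ (q a) i - u i) * (u₀ (q a) j - u j) + (if i = j then θ₀ (q a) - θ else 0)) := ⟨_, fun _ _ => rfl⟩
  -- the split of `Z` around the local means, and the bias bound
  have hZeq : ∀ i j v, Z i j v = Y i j v + P i j v + P j i v + β i j := by
    intro i j v
    by_cases hij : i = j
    · simp only [hZ, hY, hP, hβ, hR, if_pos hij, Finset.mul_sum, ← Finset.sum_sub_distrib,
        ← Finset.sum_add_distrib]
      exact Finset.sum_congr rfl fun a _ => by ring
    · simp only [hZ, hY, hP, hβ, if_neg hij, Finset.mul_sum, ← Finset.sum_add_distrib, sub_zero, mul_zero,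
        add_zero, Finset.sum_const_zero]
      exact Finset.sum_congr rfl fun a _ => by ring
  have hβle : ∀ i j, |β i j| ≤ R * (δu ^ 2 + δθ) := by
    intro i j
    rw [hβ, hR]
    refine abs_avg_mul_le hκ0 fun a ha => (abs_add_le _ _).trans (add_le_add ?_ ?_)
    · rw [abs_mul, sq]
      exact mul_le_mul (hdu a ha i) (hdu a ha j) (abs_nonneg _) ((abs_nonneg _).trans (hdu a ha i))
    · split_ifs
      · exact (hloc (q a) ha).2
      · rw [abs_zero]; exact hδθ
  -- the dominating variables `Ψ ≥ |Z|` and `Φ ≥ |A|`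
  obtain ⟨Ψ, hΨ⟩ : ∃ Ψ : Fin 3 → Fin 3 → (Fin n → V3) → ℝ, ∀ i j, Ψ i j = fun v =>
      |Y i j v| + |P i j v| + |P j i v| + R * (δu ^ 2 + δθ) := ⟨_, fun _ _ => rfl⟩
  obtain ⟨Φ, hΦ⟩ : ∃ Φ : Fin 3 → Fin 3 → (Fin n → V3) → ℝ, ∀ i j, Φ i j = fun v =>
      Ψ i j v + (∑ k, Ψ k k v) / 3 + 4 / 3 * ((∑ k, D k v ^ 2) / R) := ⟨_, fun _ _ => rfl⟩
  have hZΨ : ∀ i j v, |Z i j v| ≤ Ψ i j v := fun i j v => by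
    simp only [hZeq, hΨ]
    exact (abs_add_le _ _).trans (add_le_add (abs_add_three _ _ _) (hβle i j))
  have hΨ0 : ∀ i j v, 0 ≤ Ψ i j v := fun i j v => by simp only [hΨ]; positivity
  have hΦ0 : ∀ i j v, 0 ≤ Φ i j v := fun i j v => by
    simp only [hΦ]
    exact add_nonneg (add_nonneg (hΨ0 i j v) (div_nonneg (Finset.sum_nonneg fun k _ => hΨ0 k k v) (by norm_num)))
      (mul_nonneg (by norm_num) (div_nonneg (Finset.sum_nonneg fun k _ => sq_nonneg _) hR0))
  -- pointwise bound `|Aᵢⱼ| ≤ Φᵢⱼ` (traceless identity at the reference `(u, θ)`)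
  have hpt : ∀ (v : Fin n → V3) (i j : Fin 3),
      |(∫ y, χ y.1 * (y.2 i * y.2 j) ∂(empiricalMeasure (zipConfig (q, v)))) -
        empiricalMomentumField (zipConfig (q, v)) χ i * empiricalMomentumField (zipConfig (q, v)) χ j / R -
        (if i = j then R * (2 / 3 * (empiricalEnergyField (zipConfig (q, v)) χ / R -
            ‖empiricalMomentumField (zipConfig (q, v)) χ‖ ^ 2 / (2 * R ^ 2))) else 0)| ≤ Φ i j v := by
    intro v i j
    have h := E6.kinStatic_abs_kinEntry_le n (zipConfig (q, v)) χ hχ0 u θ i j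
    rw [hDens v] at h
    simp only [zipConfig_apply] at h
    refine le_trans ?_ (show |Z i j v| + (∑ k, |Z k k v|) / 3 + 4 / 3 * ((∑ k, D k v ^ 2) / R) ≤ Φ i j v from ?_)
    · simp only [hZ, hD]
      convert h using 3
    · simp only [hΦ]
      exact add_le_add (add_le_add (hZΨ i j v)
        (div_le_div_of_nonneg_right (Finset.sum_le_sum fun k _ => hZΨ k k v) (by norm_num))) le_rfl
  -- the centred variables `Y`: `L²`, Bienaymé, `L¹` bound
  have hYmem : ∀ i j, MemLp (Y i j) 2 (velMeasure u₀ θ₀ q) := fun i j => by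
    rw [hY, hμv]
    have h1 : ∀ a, MemLp (fun v : Fin n → V3 => (n : ℝ)⁻¹ * χ (q a) * ((v a i - u₀ (q a) i) * (v a j - u₀ (q a) j)))
        2 (Measure.pi fun b : Fin n => gaussMeasure (u₀ (q b)) (θ₀ (q b))) := fun a =>
      ((E6.kinStatic_memLp_peculiarProd (u₀ (q a)) (hθ0 _).le i j).const_mul
        ((n : ℝ)⁻¹ * χ (q a))).comp_measurePreserving
        (measurePreserving_eval (fun b : Fin n => gaussMeasure (u₀ (q b)) (θ₀ (q b))) a)
    exact (memLp_finsetSum _ fun a _ => h1 a).sub (memLp_const _)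
  have hYint : ∀ i j, Integrable (Y i j) (velMeasure u₀ θ₀ q) := fun i j => (hYmem i j).integrable one_le_two
  have hYabs : ∀ i j, ∫ v, |Y i j v| ∂(velMeasure u₀ θ₀ q) ≤
      Real.sqrt ((n : ℝ)⁻¹ * Cχ * (θM ^ 2 * M₄)) * (1 + R) / 2 := by
    intro i j
    refine (LGFS.integral_abs_le_sqrt_of_memLp (hYmem i j)).trans
      ((Real.sqrt_le_sqrt ?_).trans (LGFS.sqrt_mul_le_half hK0 hR0))
    have h := (MesoLLN.integral_sq_sum_sub_pi (μ := fun a : Fin n => gaussMeasure (u₀ (q a)) (θ₀ (q a)))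
      (X := fun a (w : V3) => (w i - u₀ (q a) i) * (w j - u₀ (q a) j))
      (fun a => E6.kinStatic_memLp_peculiarProd (u₀ (q a)) (hθ0 _).le i j)
      (fun a => (n : ℝ)⁻¹ * χ (q a)) (∑ a, (n : ℝ)⁻¹ * χ (q a) * (if i = j then θ₀ (q a) else 0))).2
    simp only [E6.kinStatic_integral_peculiarProd _ (hθ0 _), sub_self, zero_pow two_ne_zero, add_zero] at h
    simp only [hY]
    rw [hμv, h, hR]
    exact LGFS.sum_sq_mul_le hκ0 hκC (fun _ => variance_nonneg _ _)
      (fun a => (E6.kinStatic_variance_peculiarProd_le (u₀ (q a)) (hθ0 _) i j).trans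
        (by rw [← hM₄]; exact mul_le_mul_of_nonneg_right (pow_le_pow_left₀ (hθ0 _).le (hθM _) 2) hM₄0))
  -- the momentum fluctuations `P` with coefficients `χ(qₐ)(u₀(qₐ) - u)ⱼ`, and `D`
  have hPmem : ∀ i j, MemLp (P i j) 2 (velMeasure u₀ θ₀ q) ∧
      ∫ v, |P i j v| ∂(velMeasure u₀ θ₀ q) ≤ ((n : ℝ)⁻¹ * Cχ * θM + R * δu ^ 2) / 2 := by
    intro i j
    obtain ⟨hmem, hle⟩ :=
      LGFS.integral_abs_momFluct_le (u₀ := u₀) hθ0 q (fun a => χ (q a) * (u₀ (q a) j - u j)) i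
    rw [hP]
    refine ⟨hmem, hle.trans ?_⟩
    have hb : ∀ a, χ (q a) ≠ 0 → (u₀ (q a) j - u j) ^ 2 * θ₀ (q a) ≤ δu ^ 2 * θM := fun a ha =>
      mul_le_mul (by simpa only [sq_abs] using pow_le_pow_left₀ (abs_nonneg _) (hdu a ha j) 2) (hθM _)
        (hθ0 _).le (sq_nonneg _)
    calc Real.sqrt (∑ a, ((n : ℝ)⁻¹ * (χ (q a) * (u₀ (q a) j - u j))) ^ 2 * θ₀ (q a))
        = Real.sqrt (∑ a, ((n : ℝ)⁻¹ * χ (q a)) ^ 2 * ((u₀ (q a) j - u j) ^ 2 * θ₀ (q a))) := by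
          congr 1
          exact Finset.sum_congr rfl fun a _ => by ring
      _ ≤ Real.sqrt (((n : ℝ)⁻¹ * Cχ * θM) * (R * δu ^ 2)) :=
          Real.sqrt_le_sqrt ((sum_sq_mul_le_of_support hκ0 hκC (fun a => mul_nonneg (sq_nonneg _) (hθ0 _).le)
            hb).trans_eq (by rw [hR]; ring))
      _ ≤ ((n : ℝ)⁻¹ * Cχ * θM + R * δu ^ 2) / 2 :=  -- AM–GM
          Real.sqrt_le_iff.2 ⟨by positivity, by nlinarith [sq_nonneg ((n : ℝ)⁻¹ * Cχ * θM - R * δu ^ 2)]⟩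
  have hPint : ∀ i j, Integrable (P i j) (velMeasure u₀ θ₀ q) := fun i j => (hPmem i j).1.integrable one_le_two
  have hDsq : ∀ k, Integrable (fun v => D k v ^ 2) (velMeasure u₀ θ₀ q) ∧
      ∫ v, D k v ^ 2 ∂(velMeasure u₀ θ₀ q) ≤ ((n : ℝ)⁻¹ * Cχ * θM) * R + (R * δu) ^ 2 := by
    intro k
    have h := MesoLLN.integral_momCoord_sq (u₀ := u₀) (θ₀ := θ₀) hθ0 q (fun a => χ (q a))
      ((n : ℝ)⁻¹ * ∑ a, χ (q a) * u k) k
    simp only [hD]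
    refine ⟨h.1, h.2.trans_le (add_le_add ?_ ?_)⟩
    · rw [hR]; exact LGFS.sum_sq_mul_le hκ0 hκC (fun a => (hθ0 _).le) (fun a => hθM _)
    · rw [← mul_sub, ← Finset.sum_sub_distrib, hR]
      simp_rw [← mul_sub]
      exact (sq_abs _).symm.trans_le (pow_le_pow_left₀ (abs_nonneg _) (abs_avg_mul_le hκ0 fun a ha => hdu a ha k) 2)
  have hDsum : (∑ k, ∫ v, D k v ^ 2 ∂(velMeasure u₀ θ₀ q)) / R ≤ 3 * ((n : ℝ)⁻¹ * Cχ * θM + R * δu ^ 2) := by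
    rcases eq_or_lt_of_le hR0 with h0 | hpos
    · rw [← h0, div_zero]; positivity
    · rw [div_le_iff₀ hpos]
      exact (sum_fin_three_le fun k => (hDsq k).2).trans_eq (by ring)
  -- integrability and integrals of `Ψ` and `Φ`
  have hΨint : ∀ i j, Integrable (Ψ i j) (velMeasure u₀ θ₀ q) := fun i j => by
    rw [hΨ]; exact (((hYint i j).abs.add (hPint i j).abs).add (hPint j i).abs).add (integrable_const _)
  have hΨle : ∀ i j, ∫ v, Ψ i j v ∂(velMeasure u₀ θ₀ q) ≤ Real.sqrt ((n : ℝ)⁻¹ * Cχ * (θM ^ 2 * M₄)) * (1 + R) / 2 +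
      ((n : ℝ)⁻¹ * Cχ * θM + R * δu ^ 2) + R * (δu ^ 2 + δθ) := by
    intro i j
    have hI1 : Integrable (fun v => |Y i j v|) (velMeasure u₀ θ₀ q) := (hYint i j).abs
    have hI2 : Integrable (fun v => |P i j v|) (velMeasure u₀ θ₀ q) := (hPint i j).abs
    have hI3 : Integrable (fun v => |P j i v|) (velMeasure u₀ θ₀ q) := (hPint j i).abs
    have hI12 : Integrable (fun v => |Y i j v| + |P i j v|) (velMeasure u₀ θ₀ q) := hI1.add hI2
    have hI123 : Integrable (fun v => |Y i j v| + |P i j v| + |P j i v|) (velMeasure u₀ θ₀ q) := hI12.add hI3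
    simp only [hΨ]
    rw [integral_add hI123 (integrable_const _), integral_add hI12 hI3, integral_add hI1 hI2, integral_const,
      probReal_univ, one_smul]
    linarith [hYabs i j, (hPmem i j).2, (hPmem j i).2]
  have hΦint : ∀ i j, Integrable (Φ i j) (velMeasure u₀ θ₀ q) := fun i j => by
    rw [hΦ]
    exact ((hΨint i j).add ((integrable_finsetSum _ fun k _ => hΨint k k).div_const 3)).add
      (((integrable_finsetSum _ fun k _ => (hDsq k).1).div_const R).const_mul (4 / 3))
  have hΦle : ∀ i j, ∫ v, Φ i j v ∂(velMeasure u₀ θ₀ q) ≤ Real.sqrt ((n : ℝ)⁻¹ * Cχ * (θM ^ 2 * M₄)) * (1 + R) +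
      6 * ((n : ℝ)⁻¹ * Cχ * θM) + 8 * (R * δu ^ 2) + 2 * (R * δθ) := by
    intro i j
    have hI2 : Integrable (fun v => (∑ k, Ψ k k v) / 3) (velMeasure u₀ θ₀ q) :=
      (integrable_finsetSum _ fun k _ => hΨint k k).div_const 3
    have hI3 : Integrable (fun v => 4 / 3 * ((∑ k, D k v ^ 2) / R)) (velMeasure u₀ θ₀ q) :=
      ((integrable_finsetSum _ fun k _ => (hDsq k).1).div_const R).const_mul (4 / 3)
    have hI12 : Integrable (fun v => Ψ i j v + (∑ k, Ψ k k v) / 3) (velMeasure u₀ θ₀ q) := (hΨint i j).add hI2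
    simp only [hΦ]
    rw [integral_add hI12 hI3, integral_add (hΨint i j) hI2, integral_div,
      integral_finsetSum _ (fun k _ => hΨint k k), integral_const_mul, integral_div,
      integral_finsetSum _ (fun k _ => (hDsq k).1)]
    have hkk := sum_fin_three_le fun k => hΨle k k
    linarith [hΨle i j, hDsum]
  -- conclusion
  calc _ ≤ ∫⁻ v, ENNReal.ofReal (∑ i, ∑ j, Φ i j v) ∂(velMeasure u₀ θ₀ q) :=
        lintegral_mono fun v => ENNReal.ofReal_le_ofReal
          (Finset.sum_le_sum fun i _ => Finset.sum_le_sum fun j _ => hpt v i j)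
    _ = ENNReal.ofReal (∫ v, ∑ i, ∑ j, Φ i j v ∂(velMeasure u₀ θ₀ q)) :=
        (ofReal_integral_eq_lintegral_ofReal (integrable_finsetSum _ fun i _ => integrable_finsetSum _ fun j _ =>
          hΦint i j) (ae_of_all _ fun v => Finset.sum_nonneg fun i _ => Finset.sum_nonneg fun j _ => hΦ0 i j v)).symm
    _ ≤ _ := by
        refine ENNReal.ofReal_le_ofReal ?_
        rw [integral_finsetSum _ fun i _ => integrable_finsetSum _ fun j _ => hΦint i j]
        refine ((Finset.sum_congr rfl fun i _ => integral_finsetSum _ fun j _ => hΦint i j).trans_le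
          (sum_fin_three_le fun i => sum_fin_three_le fun j => hΦle i j)).trans_eq ?_
        ring

/-! ### Integration over the local Gibbs measure: the stub -/

/-- **Stub G1 (general-profile Gaussian statics of the K-integrand) of crux `FluxClosure`.** For `σ ≤ 1/2` and
continuous profiles `a₀, θ₀ > 0`, `u₀` there is `C ≥ 0` (depending on `θ₀` only: `C = 18√(θ_max² M₄) + 54 θ_max + 72`,
`θ_max = max θ₀`, `M₄ = E‖w‖⁴` for the standard Gaussian `w` on `ℝ³`) such that for every `N`, every jointly
measurable kernel `0 ≤ K ≤ C_K` with unit mass in its centre variable which is `(δu, δθ)`-local for the profiles,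
and every matrix field `|Gᵢⱼ| ≤ B`: under `localGibbsMeasure σ a₀ u₀ θ₀ N` the traceless box peculiar velocity
covariance `A = Ŝ - m̂⊗m̂/ρ̂ - ρ̂θ̂𝟙` of the `K(x, ·)`-weighted box fields tested against `G` satisfies
`E |∫ₓ Σᵢⱼ Aᵢⱼ Gᵢⱼ dx| ≤ B C (√((N+1)⁻¹C_K) + (N+1)⁻¹C_K + δθ + δu²)`. Proof: `|∫ₓ| ≤ ∫ₓ|·|`, Tonelli,
the disintegration `lintegral_localGibbsMeasure`, the conditional bound `kinStatic_lintegral_vel_general_le` at the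
reference `(u₀ x, θ₀ x)` integrated over the centres (`∫ₓ ρ̂(q, x) dx = 1`), `lintegral_posWeight_eq_one`. -/
theorem kinStatic_lintegral_localGibbs_general_le : ∀ (σ : ℝ) (a₀ θ₀ : T3 → ℝ) (u₀ : T3 → V3), σ ≤ 1 / 2 → Continuous a₀ → Continuous θ₀ → Continuous u₀ → (∀ x, 0 < a₀ x) → (∀ x, 0 < θ₀ x) → ∃ C : ℝ, 0 ≤ C ∧ ∀ (N : ℕ) (K : T3 → T3 → ℝ) (CK δu δθ : ℝ), (Measurable fun p : T3 × T3 => K p.1 p.2) → (∀ x y, 0 ≤ K x y) → (∀ x y, K x y ≤ CK) → (∀ q, ∫ x, K x q = 1) → 0 ≤ δu → 0 ≤ δθ → (∀ x y, K x y ≠ 0 → ‖u₀ y - u₀ x‖ ≤ δu ∧ |θ₀ y - θ₀ x| ≤ δθ) → ∀ (G : T3 → Fin 3 → Fin 3 → ℝ) (B : ℝ), (∀ i j, Measurable fun x => G x i j) → (∀ x i j, |G x i j| ≤ B) → ∫⁻ z, ENNReal.ofReal (|∫ x, ∑ i, ∑ j, ((∫ y, K x y.1 * (y.2 i * y.2 j)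 ∂(empiricalMeasure z)) - empiricalMomentumField z (K x) i * empiricalMomentumField z (K x) j / empiricalDensityField z (K x) - (if i = j then empiricalDensityField z (K x) * (2 / 3 * (empiricalEnergyField z (K x) / empiricalDensityField z (K x) - ‖empiricalMomentumField z (K x)‖ ^ 2 / (2 * empiricalDensityField z (K x) ^ 2))) else 0)) * G x i j|) ∂(localGibbsMeasure σ a₀ u₀ θ₀ N) ≤ ENNReal.ofReal (B * C * (Real.sqrt ((((N : ℝ) + 1))⁻¹ * CK) + (((N : ℝ) + 1))⁻¹ * CK + δθ + δu ^ 2)) := by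
  intro σ a₀ θ₀ u₀ hσ ha hθc hu ha0 hθ0
  obtain ⟨θM, hθM0, hθM⟩ := LGFS.exists_forall_le_of_continuous hθc
  obtain ⟨M₄, hM₄⟩ : ∃ M : ℝ, M = ∫ w, ‖w‖ ^ 4 ∂stdGaussian V3 := ⟨_, rfl⟩
  refine ⟨18 * Real.sqrt (θM ^ 2 * M₄) + 54 * θM + 72, by positivity, ?_⟩
  intro N K CK δu δθ hKm hK0 hKC hK1 _ hδθ hloc G B _ hGB
  -- the summed absolute integrand `F`; the constants `α, β` of the conditional bound
  obtain ⟨F, hF⟩ : ∃ F : Config (N + 1) (Fin 3) T3 → T3 → ℝ, ∀ z x, F z x = ∑ i, ∑ j,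
      |(∫ y, K x y.1 * (y.2 i * y.2 j) ∂(empiricalMeasure z)) -
        empiricalMomentumField z (K x) i * empiricalMomentumField z (K x) j / empiricalDensityField z (K x) -
        (if i = j then empiricalDensityField z (K x) * (2 / 3 * (empiricalEnergyField z (K x) / empiricalDensityField z (K x) -
          ‖empiricalMomentumField z (K x)‖ ^ 2 / (2 * empiricalDensityField z (K x) ^ 2))) else 0)| :=
    ⟨_, fun _ _ => rfl⟩
  haveI : IsProbabilityMeasure (localGibbsMeasure σ a₀ u₀ θ₀ N) :=
    isProbabilityMeasure_localGibbsMeasure ha hθc hu ha0 hθ0 hσ N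
  have hB0 : 0 ≤ B := (abs_nonneg _).trans (hGB 0 0 0)
  have hCK : 0 ≤ CK := (hK0 0 0).trans (hKC 0 0)
  obtain ⟨α, hα⟩ : ∃ α' : ℝ, α' = 9 * Real.sqrt (((N + 1 : ℕ) : ℝ)⁻¹ * CK * (θM ^ 2 * M₄)) +
      54 * (((N + 1 : ℕ) : ℝ)⁻¹ * CK * θM) := ⟨_, rfl⟩
  obtain ⟨β, hβ⟩ : ∃ β' : ℝ, β' = 9 * Real.sqrt (((N + 1 : ℕ) : ℝ)⁻¹ * CK * (θM ^ 2 * M₄)) +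
      72 * δu ^ 2 + 18 * δθ := ⟨_, rfl⟩
  have hα0 : 0 ≤ α := by rw [hα]; positivity
  have hβ0 : 0 ≤ β := by rw [hβ]; positivity
  -- joint measurability (B5) and the measurability of the `x`-integral
  have hFm : Measurable fun p : Config (N + 1) (Fin 3) T3 × T3 => ENNReal.ofReal (B * F p.1 p.2) := by
    simp only [hF]
    exact (measurable_const.mul (Finset.measurable_sum _ fun i _ => Finset.measurable_sum _ fun j _ =>
      (FluxClosureB5.measurable_kinDevIntegrand hKm i j).abs)).ennreal_ofReal
  have hGm : Measurable fun z : Config (N + 1) (Fin 3) T3 => ∫⁻ x, ENNReal.ofReal (B * F z x) :=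
    hFm.lintegral_prod_right'
  -- the kernel read at the particles: integrable in the centre, total mass one
  have hKint : ∀ y : T3, Integrable (fun x : T3 => K x y) := fun y =>
    (integrable_const CK).mono' (hKm.comp (measurable_id.prodMk measurable_const)).aestronglyMeasurable
      (ae_of_all _ fun x => by rw [Real.norm_eq_abs, abs_of_nonneg (hK0 x y)]; exact hKC x y)
  have hDint : ∀ q : Fin (N + 1) → T3, Integrable (fun x : T3 => ((N + 1 : ℕ) : ℝ)⁻¹ * ∑ a, K x (q a)) := fun q =>
    (integrable_finsetSum _ fun a _ => hKint (q a)).const_mul _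
  have hDone : ∀ q : Fin (N + 1) → T3, ∫ x : T3, ((N + 1 : ℕ) : ℝ)⁻¹ * ∑ a, K x (q a) = 1 := by
    intro q
    rw [integral_const_mul, integral_finsetSum _ (fun a _ => hKint (q a))]
    simp only [hK1, Finset.sum_const, Finset.card_univ, Fintype.card_fin, nsmul_eq_mul, mul_one]
    exact inv_mul_cancel₀ (Nat.cast_ne_zero.2 (Nat.succ_ne_zero N))
  -- step 1: the bound given the positions, integrated over the centres (uniform in the positions)
  have hq : ∀ q : Fin (N + 1) → T3,
      ∫⁻ v, (∫⁻ x, ENNReal.ofReal (B * F (zipConfig (q, v)) x)) ∂(velMeasure u₀ θ₀ q) ≤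
        ENNReal.ofReal (B * (α + β)) := by
    intro q
    have hsw : AEMeasurable (uncurry fun (v : Fin (N + 1) → V3) (x : T3) => ENNReal.ofReal (B * F (zipConfig (q, v)) x))
        ((velMeasure u₀ θ₀ q).prod volume) :=
      (hFm.comp ((measurable_zipConfig.comp (measurable_const.prodMk measurable_fst)).prodMk measurable_snd)).aemeasurable
    rw [lintegral_lintegral_swap hsw]
    have hx : ∀ x : T3, ∫⁻ v, ENNReal.ofReal (B * F (zipConfig (q, v)) x) ∂(velMeasure u₀ θ₀ q) ≤
        ENNReal.ofReal B * ENNReal.ofReal (α + β * (((N + 1 : ℕ) : ℝ)⁻¹ * ∑ a, K x (q a))) := by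
      intro x
      have hA := kinStatic_lintegral_vel_general_le (u₀ := u₀) hθ0 hθM q (χ := K x) (hK0 x) (hKC x) (u₀ x) (θ₀ x)
        (hloc x) hδθ
      rw [← hM₄, ← hα, ← hβ] at hA
      simp_rw [ENNReal.ofReal_mul hB0]
      rw [lintegral_const_mul' _ _ ENNReal.ofReal_ne_top]
      exact mul_le_mul' le_rfl (by simp only [hF]; exact hA)
    have hbint : Integrable (fun x : T3 => α + β * (((N + 1 : ℕ) : ℝ)⁻¹ * ∑ a, K x (q a))) :=
      (integrable_const _).add ((hDint q).const_mul _)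
    have hb0 : ∀ x : T3, 0 ≤ α + β * (((N + 1 : ℕ) : ℝ)⁻¹ * ∑ a, K x (q a)) := fun x => by
      have : 0 ≤ ((N + 1 : ℕ) : ℝ)⁻¹ * ∑ a, K x (q a) :=
        mul_nonneg (inv_nonneg.2 (Nat.cast_nonneg _)) (Finset.sum_nonneg fun a _ => hK0 _ _)
      positivity
    have hbval : ∫ x : T3, (α + β * (((N + 1 : ℕ) : ℝ)⁻¹ * ∑ a, K x (q a))) = α + β := by
      rw [integral_add (integrable_const _) ((hDint q).const_mul _), integral_const_mul, hDone q, integral_const,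
        probReal_univ, one_smul, mul_one]
    calc ∫⁻ x, ∫⁻ v, ENNReal.ofReal (B * F (zipConfig (q, v)) x) ∂(velMeasure u₀ θ₀ q)
        ≤ ∫⁻ x : T3, ENNReal.ofReal B * ENNReal.ofReal (α + β * (((N + 1 : ℕ) : ℝ)⁻¹ * ∑ a, K x (q a))) :=
          lintegral_mono hx
      _ = ENNReal.ofReal B * ENNReal.ofReal (∫ x : T3, (α + β * (((N + 1 : ℕ) : ℝ)⁻¹ * ∑ a, K x (q a)))) := by
          rw [lintegral_const_mul' _ _ ENNReal.ofReal_ne_top, ofReal_integral_eq_lintegral_ofReal hbint (ae_of_all _ hb0)]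
      _ = _ := by rw [hbval, ← ENNReal.ofReal_mul hB0]
  -- step 2: `|∫ₓ Σ A G| ≤ ∫ₓ B Σ|A|`, disintegration into positions and velocities, assembly
  refine (lintegral_mono fun z => show _ ≤ ∫⁻ x, ENNReal.ofReal (B * F z x) from
    (ENNReal.ofReal_le_ofReal (abs_integral_le_integral_abs)).trans
      ((LGFS.ofReal_integral_le_lintegral_ofReal' fun x => abs_nonneg _).trans (lintegral_mono fun x =>
        ENNReal.ofReal_le_ofReal (by rw [hF]; exact E6.kinStatic_abs_sum_mul_le (hGB x))))).trans ?_
  rw [lintegral_localGibbsMeasure ha hθc hu (fun x => (ha0 x).le) hθ0 σ N hGm]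
  refine (lintegral_mono fun q => mul_le_mul' le_rfl (hq q)).trans ?_
  rw [lintegral_mul_const' _ _ ENNReal.ofReal_ne_top,
    lintegral_posWeight_eq_one ha hθc hu (fun x => (ha0 x).le) hθ0 σ N, one_mul]
  -- step 3: the constant
  refine ENNReal.ofReal_le_ofReal ?_
  rw [mul_assoc]
  refine mul_le_mul_of_nonneg_left ?_ hB0
  rw [hα, hβ, show (((N + 1 : ℕ) : ℝ))⁻¹ = ((N : ℝ) + 1)⁻¹ by rw [Nat.cast_add_one]]
  have ht0 : 0 ≤ ((N : ℝ) + 1)⁻¹ * CK := by positivity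
  have hS0 := Real.sqrt_nonneg (θM ^ 2 * M₄)
  have hs0 := Real.sqrt_nonneg (((N : ℝ) + 1)⁻¹ * CK)
  rw [Real.sqrt_mul ht0]
  nlinarith [mul_nonneg hS0 ht0, mul_nonneg hS0 hδθ, mul_nonneg hS0 (sq_nonneg δu), mul_nonneg hθM0 hs0,
    mul_nonneg hθM0 hδθ, mul_nonneg hθM0 (sq_nonneg δu), mul_nonneg hS0 hs0, mul_nonneg hθM0 ht0, sq_nonneg δu]

end FluxClosureEq.G1
end Summit.AtomisticToContinuum.HydrodynamicLimit.Theorems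

end
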